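import Mathlib
import Summits.NavierStokesRegularity.NavierStokesRegularity.Theorems.WakeRatchetTailRatchetScalarFrontAmplitude
import HarnessLib

/-!
# Scalar dyadic fronts (construction `DyadicScalarFronts`, stmt-NavierStokesRegularity-21808):
# the LEADING EDGE — the renormalised amplitude vanishes in the past and obeys the SQUARING LAW
# `sup_{u ≤ st} |u|a(u) ≤ Λ·(sup_{u ≤ t} |u|a(u))²`, hence decays doubly exponentially

Support file for the crux `WakeRatchet.TailRatchet` (stmt-21808; refuted BY NAME modulo the construction
`WakeRatchetDyadicFront.DyadicScalarFronts`, p589335; MODEL lattice ODEs of Tao 2016 §1.2, §4 — nothing here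
concerns the Navier–Stokes equations, and no item is closed).  Tightness at the leading edge for the continuation
programme R-glob (census G1: compactness of the branch of fronts).

For a profile `a > 0` of `a' = (Λ/s²)a(t/s)² − (s/Λ)a(t)a(st)` on `t < 0` entering from rest, with renormalised
amplitude `g(t) = |t|·a(t)`:
* `amp_le_sq` — **squaring law**: if `g ≤ M` on `(−∞, τ]` (`τ < 0`, `M ≥ 0`) then `g ≤ Λ·M²` on `(−∞, sτ]`
  (the drain is non-negative, so `a' ≤ (Λ/s²)a(t/s)² ≤ ΛM²/t²` there, and `a + ΛM²/t` is non-increasing and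
  tends to `0` at `−∞`);
* `amp_le_iter` — iterating outwards: `g ≤ Λ⁻¹·(ΛM)^{2^k}` on `(−∞, s^k τ]`;
* `amp_tendsto_zero` — for every profile of `DyadicScalarFronts`, `g(t) → 0` as `t → −∞` (log-Lipschitz
  bound of `…ScalarFrontAmplitude` + integrability: a value `g(t₁) ≥ ε` costs a fixed amount `∝ ε²` of `∫ a`
  on the window `[c t₁, t₁]`, against the vanishing tail integral);
* `doubly_exponential_edge` — hence there is `τ < 0` with `|t|·a(t) ≤ Λ⁻¹·2^{−2^k}` for all `t ≤ s^k τ`,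
  `k ∈ ℕ`: the leading edge of EVERY admissible scalar dyadic front is doubly exponential in the number of
  rungs (`≈ exp(−c|t|^{log 2/ log s})`), the shape found for the inner front in item evidence
  `DOORS-21808-leafhand-g1.md` and assumed by the truncated-lattice boxes of `…TailRatchetLeadingEdge`.

HONEST FRAMING: elementary real analysis about a MODEL lattice ODE; existence of fronts is NOT proved; nothing
about Navier–Stokes.
-/

noncomputable section

set_option linter.dupNamespace false

namespace Summit.NavierStokesRegularity.NavierStokesRegularity.Theorems

namespace WakeRatchetScalarFrontEdge

open Filter Topology Set MeasureTheory intervalIntegral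
open Literature.Analysis.FluidPDE Literature.Analysis.FluidPDE.TaoCascade
open WakeRatchetScalarFrontWake WakeRatchetScalarFrontPositive WakeRatchetScalarFrontAmplitude

variable {ε₀ s : ℝ} {a : ℝ → ℝ}

/-! ## The squaring law -/

/-- **Squaring law at the leading edge.**  For a non-negative profile entering from rest: if `|u|·a(u) ≤ M`
for all `u ≤ τ` (`τ < 0`), then `|t|·a(t) ≤ Λ·M²` for all `t ≤ sτ`.
[cite: Tao2016AveragedNS, §1.2 (dyadic model); elementary] -/
theorem amp_le_sq (hε : 0 < ε₀) (hs : 1 < s)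
    (hode : ∀ t : ℝ, t < 0 → HasDerivAt a
      (bigLam ε₀ / s ^ 2 * a (t / s) ^ 2 - s / bigLam ε₀ * a t * a (s * t)) t)
    (hnn : ∀ t : ℝ, t < 0 → 0 ≤ a t) (hbot : Tendsto a atBot (𝓝 0))
    {τ M : ℝ} (hτ : τ < 0) (hM : ∀ u : ℝ, u ≤ τ → -u * a u ≤ M)
    {t : ℝ} (ht : t ≤ s * τ) : -t * a t ≤ bigLam ε₀ * M ^ 2 := by
  have hs0 : 0 < s := by linarith
  have hΛ : 0 < bigLam ε₀ := bigLam_pos (by linarith)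
  have hsτ : s * τ < 0 := mul_neg_of_pos_of_neg hs0 hτ
  have ht0 : t < 0 := lt_of_le_of_lt ht hsτ
  -- on `u < sτ`: `a'(u) ≤ Λ M² / u²`
  have hder : ∀ u : ℝ, u ≤ s * τ →
      bigLam ε₀ / s ^ 2 * a (u / s) ^ 2 - s / bigLam ε₀ * a u * a (s * u) ≤ bigLam ε₀ * M ^ 2 / u ^ 2 := by
    intro u hu
    have hu0 : u < 0 := lt_of_le_of_lt hu hsτ
    have hus : u / s ≤ τ := by rw [div_le_iff₀ hs0]; linarith
    have hus0 : u / s < 0 := div_neg_of_neg_of_pos hu0 hs0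
    have h1 : a (u / s) ≤ M / (-(u / s)) := by
      rw [le_div_iff₀ (by linarith), mul_comm]; exact hM _ hus
    have h2 : a (u / s) ^ 2 ≤ (M / (-(u / s))) ^ 2 := pow_le_pow_left₀ (hnn _ hus0) h1 2
    have h3 : 0 ≤ s / bigLam ε₀ * a u * a (s * u) :=
      mul_nonneg (mul_nonneg (div_pos hs0 hΛ).le (hnn u hu0)) (hnn _ (mul_neg_of_pos_of_neg hs0 hu0))
    have hune : u ≠ 0 := hu0.ne
    have h4 : bigLam ε₀ / s ^ 2 * (M / (-(u / s))) ^ 2 = bigLam ε₀ * M ^ 2 / u ^ 2 := by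
      field_simp
    calc bigLam ε₀ / s ^ 2 * a (u / s) ^ 2 - s / bigLam ε₀ * a u * a (s * u)
        ≤ bigLam ε₀ / s ^ 2 * a (u / s) ^ 2 := by linarith
      _ ≤ bigLam ε₀ / s ^ 2 * (M / (-(u / s))) ^ 2 := mul_le_mul_of_nonneg_left h2 (by positivity)
      _ = bigLam ε₀ * M ^ 2 / u ^ 2 := h4
  -- `φ(u) = a(u) + Λ M² / u` is non-increasing on `(−∞, sτ]`
  set φ : ℝ → ℝ := fun u => a u + bigLam ε₀ * M ^ 2 / u with hφ
  have hφ' : ∀ u, u < s * τ → HasDerivAt φ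
      (bigLam ε₀ / s ^ 2 * a (u / s) ^ 2 - s / bigLam ε₀ * a u * a (s * u) - bigLam ε₀ * M ^ 2 / u ^ 2) u := by
    intro u hu
    have hu0 : u ≠ 0 := (lt_of_lt_of_le hu hsτ.le).ne
    have h1 : HasDerivAt (fun u : ℝ => bigLam ε₀ * M ^ 2 / u) (-(bigLam ε₀ * M ^ 2) / u ^ 2) u := by
      have := (hasDerivAt_inv hu0).const_mul (bigLam ε₀ * M ^ 2)
      refine this.congr_of_eventuallyEq ?_ |>.congr_deriv (by ring)
      exact Eventually.of_forall fun v => by simp [div_eq_mul_inv]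
    exact ((hode u (lt_of_lt_of_le hu hsτ.le)).add h1).congr_deriv (by ring)
  have hanti : AntitoneOn φ (Iio (s * τ)) := by
    refine antitoneOn_of_hasDerivWithinAt_nonpos (convex_Iio _)
      (f' := fun u => bigLam ε₀ / s ^ 2 * a (u / s) ^ 2 - s / bigLam ε₀ * a u * a (s * u)
        - bigLam ε₀ * M ^ 2 / u ^ 2)
      (fun u hu => (hφ' u hu).continuousAt.continuousWithinAt) ?_ ?_
    · intro u hu
      rw [interior_Iio] at hu
      exact (hφ' u hu).hasDerivWithinAt
    · intro u hu
      rw [interior_Iio] at hu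
      have := hder u hu.le
      show bigLam ε₀ / s ^ 2 * a (u / s) ^ 2 - s / bigLam ε₀ * a u * a (s * u)
        - bigLam ε₀ * M ^ 2 / u ^ 2 ≤ 0
      linarith
  -- compare `t' < sτ` with `T → −∞`, then pass to `t` by continuity if `t = sτ`
  have key : ∀ t' : ℝ, t' < s * τ → -t' * a t' ≤ bigLam ε₀ * M ^ 2 := by
    intro t' ht'
    have ht'0 : t' < 0 := ht'.trans hsτ
    -- `a t' ≤ a T + Λ M²/|t'|` for all `T ≤ t'`... via antitone: φ t' ≤ φ T ≤ a T
    have hle : ∀ T : ℝ, T ≤ t' → a t' + bigLam ε₀ * M ^ 2 / t' ≤ a T := by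
      intro T hT
      have hT0 : T < s * τ := lt_of_le_of_lt hT ht'
      have h := hanti (show T ∈ Iio (s * τ) from hT0) (show t' ∈ Iio (s * τ) from ht') hT
      have hTneg : T < 0 := hT0.trans hsτ
      have hdivle : bigLam ε₀ * M ^ 2 / T ≤ 0 :=
        div_nonpos_of_nonneg_of_nonpos (by positivity) hTneg.le
      have h' : φ t' ≤ φ T := h
      simp only [hφ] at h'
      linarith
    -- let `T → −∞`
    have hlim : a t' + bigLam ε₀ * M ^ 2 / t' ≤ 0 := by
      refine ge_of_tendsto hbot ?_
      filter_upwards [eventually_le_atBot t'] with T hT using hle T hT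
    have e : bigLam ε₀ * M ^ 2 / t' = -(bigLam ε₀ * M ^ 2) / (-t') := by
      rw [neg_div_neg_eq]
    rw [e] at hlim
    have ht'pos : 0 < -t' := by linarith
    have : a t' ≤ bigLam ε₀ * M ^ 2 / (-t') := by
      rw [neg_div] at hlim; linarith
    rw [le_div_iff₀ ht'pos] at this
    linarith
  rcases ht.lt_or_eq with hlt | heq
  · exact key t hlt
  · -- `t = sτ`: continuity of `u ↦ -u·a(u)` from the left
    have hcont : ContinuousAt (fun u : ℝ => -u * a u) t :=
      (hasDerivAt_amp hode ht0).continuousAt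
    have htend : Tendsto (fun u : ℝ => -u * a u) (𝓝[<] t) (𝓝 (-t * a t)) :=
      hcont.continuousWithinAt.tendsto
    refine le_of_tendsto htend ?_
    filter_upwards [self_mem_nhdsWithin] with u hu
    exact key u (by rw [← heq]; exact hu)

/-- **Iterated squaring law.**  If `|u|·a(u) ≤ M` on `(−∞, τ]` then `|t|·a(t) ≤ Λ⁻¹·(ΛM)^{2^k}` on
`(−∞, s^k τ]`, for every `k`. [cite: Tao2016AveragedNS, §1.2; elementary] -/
theorem amp_le_iter (hε : 0 < ε₀) (hs : 1 < s)
    (hode : ∀ t : ℝ, t < 0 → HasDerivAt a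
      (bigLam ε₀ / s ^ 2 * a (t / s) ^ 2 - s / bigLam ε₀ * a t * a (s * t)) t)
    (hnn : ∀ t : ℝ, t < 0 → 0 ≤ a t) (hbot : Tendsto a atBot (𝓝 0))
    {τ M : ℝ} (hτ : τ < 0) (hM : ∀ u : ℝ, u ≤ τ → -u * a u ≤ M) (k : ℕ) :
    ∀ t : ℝ, t ≤ s ^ k * τ → -t * a t ≤ (bigLam ε₀)⁻¹ * (bigLam ε₀ * M) ^ (2 ^ k) := by
  have hs0 : 0 < s := by linarith
  have hΛ : 0 < bigLam ε₀ := bigLam_pos (by linarith)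
  induction k with
  | zero =>
    intro t ht
    rw [pow_zero, one_mul] at ht
    have := hM t ht
    rw [pow_zero, pow_one, ← mul_assoc, inv_mul_cancel₀ hΛ.ne', one_mul]
    exact this
  | succ k ih =>
    intro t ht
    have hτk : s ^ k * τ < 0 := mul_neg_of_pos_of_neg (pow_pos hs0 k) hτ
    have h := amp_le_sq hε hs hode hnn hbot hτk ih (t := t) (by rw [pow_succ] at ht; linarith [ht])
    calc -t * a t ≤ bigLam ε₀ * ((bigLam ε₀)⁻¹ * (bigLam ε₀ * M) ^ (2 ^ k)) ^ 2 := h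
      _ = (bigLam ε₀)⁻¹ * (bigLam ε₀ * M) ^ (2 ^ (k + 1)) := by
          rw [show (2:ℕ) ^ (k + 1) = 2 ^ k * 2 from pow_succ 2 k, pow_mul]
          field_simp

/-! ## The amplitude vanishes in the past -/

/-- **The renormalised amplitude vanishes at the leading edge**: for every profile of `DyadicScalarFronts`,
`|t|·a(t) → 0` as `t → −∞` (the DSS profile of the dictionary wave tends to `0` behind... i.e. ahead of the
front).  [cite: Tao2016AveragedNS, §1.2, §4; elementary] -/
theorem amp_tendsto_zero (hε : 0 < ε₀) (hs : 1 < s)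
    (hode : ∀ t : ℝ, t < 0 → HasDerivAt a
      (bigLam ε₀ / s ^ 2 * a (t / s) ^ 2 - s / bigLam ε₀ * a t * a (s * t)) t)
    (hint : IntegrableOn a (Iio 0))
    (hbdd : ∃ t₀ : ℝ, t₀ < 0 ∧ ∃ P : ℝ, ∀ t : ℝ, t₀ ≤ t → t < 0 → |a t| ≤ P) :
    Tendsto (fun t : ℝ => -t * a t) atBot (𝓝 0) := by
  have hs0 : 0 < s := by linarith
  have hΛ : 0 < bigLam ε₀ := bigLam_pos (by linarith)
  obtain ⟨m, hm⟩ := WakeRatchetScalarFrontAdmissible.scale_bound hε hs hode hint hbdd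
  have hnn := nonneg_of_front hε hs hode hint hbdd
  have hm0 : 0 ≤ m := le_trans (by positivity) (hm (-1) (by norm_num))
  set K : ℝ := m + bigLam ε₀ * m ^ 2 + m ^ 2 / bigLam ε₀ + 1 with hK
  have hK0 : 0 < K := by positivity
  -- tail integrals vanish
  have hIic : IntegrableOn a (Iic 0) := (integrableOn_Iic_iff_integrableOn_Iio (by finiteness)).2 hint
  have htail : Tendsto (fun τ : ℝ => ∫ u in Iic τ, a u) atBot (𝓝 0) :=
    MeasureTheory.tendsto_integral_Iic_zero tendsto_id
  rw [Metric.tendsto_nhds]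
  intro ε hεp
  -- the cost of a value `≥ ε`: `η = ε²/(4K c)`, `c = 1 + ε/(2K)`
  set c : ℝ := 1 + ε / (2 * K) with hc
  have hc1 : 1 < c := by rw [hc]; have := div_pos hεp (by positivity : (0:ℝ) < 2 * K); linarith
  set η : ℝ := ε / 2 / c * (c - 1) with hη
  have hη0 : 0 < η := by positivity
  have hev := (Metric.tendsto_nhds.1 htail) η hη0
  filter_upwards [hev, eventually_lt_atBot (0 : ℝ)] with t₁ ht₁ ht₁0
  rw [Real.dist_eq, sub_zero] at ht₁ ⊢
  rw [abs_of_nonneg (mul_nonneg (by linarith) (hnn t₁ ht₁0))]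
  by_contra hge
  push Not at hge
  -- on the window `[c t₁, t₁]` the amplitude stays `≥ ε/2`
  have hct : c * t₁ < t₁ := by nlinarith
  have hwin : ∀ u ∈ Icc (c * t₁) t₁, ε / 2 ≤ -u * a u := by
    intro u hu
    have hu0 : u < 0 := lt_of_le_of_lt hu.2 ht₁0
    -- mean value inequality with `|g'| ≤ (K-1)/|t₁| ≤ K/|t₁|` on the window
    have hseg : ∀ v ∈ Icc (c * t₁) t₁, HasDerivWithinAt (fun u => -u * a u)
        (-a v - v * (bigLam ε₀ / s ^ 2 * a (v / s) ^ 2 - s / bigLam ε₀ * a v * a (s * v))) (Icc (c * t₁) t₁) v :=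
      fun v hv => (hasDerivAt_amp hode (lt_of_le_of_lt hv.2 ht₁0)).hasDerivWithinAt
    have hbound : ∀ v ∈ Icc (c * t₁) t₁,
        ‖-a v - v * (bigLam ε₀ / s ^ 2 * a (v / s) ^ 2 - s / bigLam ε₀ * a v * a (s * v))‖ ≤ K / (-t₁) := by
      intro v hv
      have hv0 : v < 0 := lt_of_le_of_lt hv.2 ht₁0
      have hnv : -t₁ ≤ -v := by linarith [hv.2]
      have h := abs_mul_deriv_amp_le hε hs hm hv0
      rw [abs_mul, abs_of_pos (by linarith : (0:ℝ) < -v)] at h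
      rw [Real.norm_eq_abs, le_div_iff₀ (by linarith : (0:ℝ) < -t₁)]
      calc _ ≤ |-a v - v * (bigLam ε₀ / s ^ 2 * a (v / s) ^ 2 - s / bigLam ε₀ * a v * a (s * v))| * (-v) :=
            mul_le_mul_of_nonneg_left hnv (abs_nonneg _)
        _ = (-v) * |-a v - v * (bigLam ε₀ / s ^ 2 * a (v / s) ^ 2 - s / bigLam ε₀ * a v * a (s * v))| := by
            ring
        _ ≤ m + bigLam ε₀ * m ^ 2 + m ^ 2 / bigLam ε₀ := h
        _ ≤ K := by rw [hK]; linarith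
    have hmv := Convex.norm_image_sub_le_of_norm_hasDerivWithin_le
      (f' := fun v => -a v - v * (bigLam ε₀ / s ^ 2 * a (v / s) ^ 2 - s / bigLam ε₀ * a v * a (s * v)))
      hseg hbound (convex_Icc _ _) (right_mem_Icc.2 hct.le) hu
    simp only [Real.norm_eq_abs] at hmv
    have hdist : |u - t₁| ≤ (-t₁) * (c - 1) := by
      rw [abs_of_nonpos (by linarith [hu.2])]
      nlinarith [hu.1]
    have h2 : K / -t₁ * |u - t₁| ≤ K / -t₁ * ((-t₁) * (c - 1)) :=
      mul_le_mul_of_nonneg_left hdist (div_pos hK0 (by linarith)).le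
    have hKne : K ≠ 0 := hK0.ne'
    have ht₁ne : t₁ ≠ 0 := ht₁0.ne
    have h3 : K / -t₁ * ((-t₁) * (c - 1)) = ε / 2 := by
      rw [hc]; field_simp; ring
    have h4 : |-u * a u - -t₁ * a t₁| ≤ ε / 2 := by linarith
    have := neg_abs_le (-u * a u - -t₁ * a t₁)
    linarith
  -- hence `a ≥ (ε/2)/(c|t₁|)` on the window and the window integral is `≥ η`
  have hIa : IntervalIntegrable a volume (c * t₁) t₁ := by
    rw [intervalIntegrable_iff_integrableOn_Ioc_of_le hct.le]
    exact hint.mono_set fun u hu => lt_of_le_of_lt hu.2 ht₁0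
  have ht₁ne : t₁ ≠ 0 := ht₁0.ne
  have hcne : c ≠ 0 := by linarith
  have hlow : η ≤ ∫ u in (c * t₁)..t₁, a u := by
    have hconst : ∫ u in (c * t₁)..t₁, (ε / 2 / (c * (-t₁)) : ℝ) = η := by
      rw [intervalIntegral.integral_const, smul_eq_mul, hη]
      field_simp
      ring
    rw [← hconst]
    refine intervalIntegral.integral_mono_on hct.le intervalIntegrable_const hIa fun u hu => ?_
    have hu0 : u < 0 := lt_of_le_of_lt hu.2 ht₁0
    have hw := hwin u hu
    have hcu : -u ≤ c * (-t₁) := by linarith [hu.1]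
    rw [div_le_iff₀ (by nlinarith : (0:ℝ) < c * (-t₁))]
    calc ε / 2 ≤ -u * a u := hw
      _ ≤ c * (-t₁) * a u := mul_le_mul_of_nonneg_right hcu (hnn u hu0)
      _ = a u * (c * -t₁) := by ring
  -- but the window lies in `(−∞, t₁]`, whose integral is `< η`
  have hup : ∫ u in (c * t₁)..t₁, a u ≤ ∫ u in Iic t₁, a u := by
    rw [intervalIntegral.integral_of_le hct.le]
    have hsub : (Ioc (c * t₁) t₁ : Set ℝ) ≤ Iic t₁ := fun u hu => hu.2
    exact setIntegral_mono_set (hIic.mono_set (Iic_subset_Iic.2 ht₁0.le))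
      ((ae_restrict_iff' measurableSet_Iic).2 (Eventually.of_forall fun u hu =>
        hnn u (lt_of_le_of_lt hu ht₁0)))
      hsub.eventuallyLE
  have hne : ∫ u in Iic t₁, a u < η := lt_of_abs_lt ht₁
  linarith

/-- **Doubly exponential leading edge.**  For every profile of `DyadicScalarFronts` there is `τ < 0` such that
`|t|·a(t) ≤ Λ⁻¹ · (1/2)^{2^k}` for all `k ∈ ℕ` and all `t ≤ s^k τ`.
[cite: Tao2016AveragedNS, §1.2, §4; elementary] -/
theorem doubly_exponential_edge (hε : 0 < ε₀) (hs : 1 < s)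
    (hode : ∀ t : ℝ, t < 0 → HasDerivAt a
      (bigLam ε₀ / s ^ 2 * a (t / s) ^ 2 - s / bigLam ε₀ * a t * a (s * t)) t)
    (hint : IntegrableOn a (Iio 0))
    (hbdd : ∃ t₀ : ℝ, t₀ < 0 ∧ ∃ P : ℝ, ∀ t : ℝ, t₀ ≤ t → t < 0 → |a t| ≤ P) :
    ∃ τ : ℝ, τ < 0 ∧ ∀ (k : ℕ) (t : ℝ), t ≤ s ^ k * τ →
      -t * a t ≤ (bigLam ε₀)⁻¹ * (1 / 2) ^ (2 ^ k) := by
  have hΛ : 0 < bigLam ε₀ := bigLam_pos (by linarith)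
  have hnn := nonneg_of_front hε hs hode hint hbdd
  have hbot := WakeRatchetScalarFrontAdmissible.tendsto_atBot hε hs hode hint hbdd
  have hg := amp_tendsto_zero hε hs hode hint hbdd
  have hM0 : 0 < 1 / (2 * bigLam ε₀) := by positivity
  have hev := (Metric.tendsto_nhds.1 hg) _ hM0
  obtain ⟨τ, hτ⟩ := (hev.and (eventually_lt_atBot (0 : ℝ))).exists_forall_of_atBot
  refine ⟨τ, (hτ τ le_rfl).2, fun k t ht => ?_⟩
  have hM : ∀ u : ℝ, u ≤ τ → -u * a u ≤ 1 / (2 * bigLam ε₀) := by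
    intro u hu
    have h := (hτ u hu).1
    rw [Real.dist_eq, sub_zero] at h
    exact (le_abs_self _).trans h.le
  have h := amp_le_iter hε hs hode hnn hbot (hτ τ le_rfl).2 hM k t ht
  have e : bigLam ε₀ * (1 / (2 * bigLam ε₀)) = 1 / 2 := by field_simp
  rwa [e] at h

end WakeRatchetScalarFrontEdge

end Summit.NavierStokesRegularity.NavierStokesRegularity.Theorems

end
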